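import Literature.Analysis.UnboundedOperators.LinearizedBoltzmannIsotropyProofs
import Literature.Analysis.UnboundedOperators.LinearizedBoltzmannOperator
import Mathlib.MeasureTheory.Measure.Lebesgue.VolumeOfBalls
import HarnessLib

/-!
# Rotation symmetry of the collision frequency and the dipole (`ℓ = 1`) projection on `S²`
# (helpers `t12_collisionFrequency_radial`, `t12_dipoleProfile_of_dipole` of the line `birth`,
# crux `TwoClocks.EquilibriumFastWindowLD`, stmt-AtomisticToContinuum-14440; infrastructure file 1 of the
# analytic residue `t12_logLinearPreimage_and_dipoleModulus` of `stub_correctorTransfer`)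

The registered sub-goal `t12_logLinearPreimage_and_dipoleModulus` (log-linear Chapman–Enskog pre-image of
quadratic data under the linearised hard-sphere operator `L` of `ℝ³`, with a radial log-modulus of the dipole
profile) is analysed sector by sector in the angular variable (`ℓ = 0`, `ℓ = 1`, `ℓ ≥ 2`). Its `ℓ = 1` clause
is stated through the **dipole profile** `Φ_ψ(r) := (3 / (4π r)) ∫_{S²} ψ(r ω) ω dσ(ω)` (`dipoleProfile ψ r`),
so that the dipole part of `ψ` is `Π₁ψ(v) = ⟪Φ_ψ(|v|), v⟫`. This file supplies the velocity-space (`N`-free)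
identities behind that clause:

* (Z1, isotropy) the tree has `L (g ∘ R) = (L g) ∘ R`, `⟪g ∘ R, h ∘ R⟫_M = ⟪g, h⟫_M` for every linear
  isometry `R` (`LinearizedBoltzmannIsotropyProofs`); we add the third member of Grad's splitting
  `L = -ν + K`: **`ν(R v) = ν(v)`** (`collisionFrequency_linearIsometryEquiv`, any finite-dimensional `E`),
  hence `ν` is a function of the speed (`collisionFrequency_eq_of_norm_eq`; registered form
  `t12_collisionFrequency_radial`) and even.
* (moments of `σ` on `S² ⊂ ℝ³`) `σ(S²) = 4π`; odd integrands integrate to zero (`∫ ω dσ = 0`); the second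
  moments **`∫ ⟪a, ω⟫² dσ = (4π/3)|a|²`**, `∫ ⟪a, ω⟫⟪c, ω⟫ dσ = (4π/3)⟪a, c⟫`, and the vector form
  **`∫ ⟪a, ω⟫ ω dσ = (4π/3) a`** (`integral_sphere_inner_smul`) — coordinate-free: the quadratic form
  `a ↦ ∫⟪a, ω⟫² dσ` is invariant under isometries (`integral_sphere_comp_isometry`), reflections act
  transitively on spheres (`Submodule.reflection_sub`), its trace over an orthonormal basis is
  `∫ |ω|² dσ = 4π`; then polarisation.
* (Z2, the dipole projection) `dipoleProfile` and its calculus: homogeneity/additivity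
  (`dipoleProfile_const_mul/_neg/_add/_sub`), locality on the sphere `|v| = r` (`dipoleProfile_congr`,
  `dipoleProfile_eq_zero_of_forall`), rotation equivariance **`Φ_{ψ∘R}(r) = R⁻¹ Φ_ψ(r)`**
  (`dipoleProfile_comp_linearIsometryEquiv`), the sup bound **`|Φ_ψ(r)| ≤ 3 sup_{|v|=r}|ψ| / r`**
  (`norm_dipoleProfile_le`), radial (`ℓ = 0`) functions have zero profile (`dipoleProfile_radial`), the
  **reproduction of dipoles** `ψ(v) = ⟪Φ(|v|), v⟫ ⟹ Φ_ψ(r) = Φ(r)` (`r > 0`; registered form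
  `t12_dipoleProfile_of_dipole`; corollaries `dipoleProfile_inner_mul_radial` (`⟪a, v⟫ φ(|v|) ↦ φ(r) a`),
  `dipoleProfile_inner_const`, `dipoleProfile_collisionInvariant` (`a + ⟪b, v⟫ + c|v|² ↦ b`), idempotence
  `dipoleProfile_dipolePart`), and continuity of `r ↦ Φ_ψ(r)` on `(0, ∞)` for continuous `ψ`.

Design. `dipoleProfile ψ r` is the expression of the sub-goal's last clause,
`(3 / (4 * Real.pi * r)) • ∫ ω : S², ψ (r • ω) • ω ∂sphereMeasure` (which then reads
`‖dipoleProfile ψ r - dipoleProfile ψ S‖ ≤ c C_g (1 + log (S/r))`); junk value `0` at `r = 0` (`x / 0 = 0`),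
never used. NOT here: the commutation `Π₁ L = L Π₁` (needs the rotation average over the stabiliser of
`v̂`), the `M`-pairing of `Π₁ψ` with the invariants in polar coordinates, anything about `ℓ ≥ 2`.

References: Cercignani–Illner–Pulvirenti 1994 §7.2–7.3 (isotropy of `L`, p. 209); Grad 1963 §4.
-/
noncomputable section

open MeasureTheory ProbabilityTheory Real Set Filter Metric
open scoped ENNReal BigOperators InnerProductSpace

namespace Summit.AtomisticToContinuum.HydrodynamicLimit.Theorems.ClampedCorrectorBirth

open Literature.Analysis.FluidPDE Literature.MathematicalPhysics.KineticTheory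
open Literature.Analysis.UnboundedOperators

local notation "E3" => EuclideanSpace ℝ (Fin 3)
local notation "S2" => Metric.sphere (0 : EuclideanSpace ℝ (Fin 3)) 1

/-! ### Z1: the collision frequency is isotropic -/

section General

variable {E : Type*} [NormedAddCommGroup E] [InnerProductSpace ℝ E] [FiniteDimensional ℝ E]
  [MeasurableSpace E] [BorelSpace E]

/-- **The hard-sphere collision frequency is isotropic**: `ν(R v) = ν(v)` for every linear isometry `R`
of the velocity space (substitute `v_* ↦ R v_*`, the Gaussian being `R`-invariant, and `ω ↦ R ω`, the
surface measure being `R`-invariant; the kernel `((v - v_*)·ω)₊` is `R`-invariant). Third member of the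
isotropy of Grad's splitting `L = -ν + K` (Cercignani–Illner–Pulvirenti 1994 §7.3, proof of Thm 7.3.6,
p. 209: `L` commutes with rotations). [folklore] -/
theorem collisionFrequency_linearIsometryEquiv (A : E ≃ₗᵢ[ℝ] E) (v : E) :
    collisionFrequency (A v) = collisionFrequency v := by
  unfold collisionFrequency
  refine ((measurePreserving_linearIsometryEquiv_stdGaussian A).integral_comp
    A.toHomeomorph.measurableEmbedding
    (fun w => ∫ ω, hardSphereKernel (A v, w) ω ∂sphereMeasure)).symm.trans ?_
  congr 1 with w
  refine (integral_sphere_comp_isometry A (fun ω => hardSphereKernel (A v, A w) ω)).symm.trans ?_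
  congr 1 with ω
  exact hardSphereKernel_linearIsometryEquiv A v w ω

/-- **The collision frequency is a function of the speed**: `|v| = |w| ⟹ ν(v) = ν(w)` (the reflection in
the hyperplane `(v - w)^⊥` is a linear isometry mapping `v` to `w`). [folklore] -/
theorem collisionFrequency_eq_of_norm_eq {v w : E} (h : ‖v‖ = ‖w‖) :
    collisionFrequency v = collisionFrequency w := by
  rw [← collisionFrequency_linearIsometryEquiv ((ℝ ∙ (v - w))ᗮ.reflection) v, Submodule.reflection_sub h]

/-- The collision frequency is even: `ν(-v) = ν(v)`. [folklore] -/
theorem collisionFrequency_neg (v : E) : collisionFrequency (-v) = collisionFrequency v :=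
  collisionFrequency_eq_of_norm_eq (norm_neg v)

/-- On the sphere of radius `r` the collision frequency is constant: `ν(r ω) = ν(r ω')`. [folklore] -/
theorem collisionFrequency_smul_sphere_eq (r : ℝ) (ω ω' : sphere (0 : E) 1) :
    collisionFrequency (r • (ω : E)) = collisionFrequency (r • (ω' : E)) :=
  collisionFrequency_eq_of_norm_eq
    (by rw [norm_smul, norm_smul, norm_eq_of_mem_sphere ω, norm_eq_of_mem_sphere ω'])

end General

/-- **Registered helper `t12_collisionFrequency_radial`** (Z1): the hard-sphere collision frequency of
`ℝ³` is radial, `|v| = |w| ⟹ ν(v) = ν(w)` — so that the sector (`ℓ = 0, 1, ≥ 2`) equations of the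
corrector analysis have the scalar coefficient `ν(|v|)`. [folklore] -/
theorem t12_collisionFrequency_radial : ∀ v w : EuclideanSpace ℝ (Fin 3), ‖v‖ = ‖w‖ → Literature.Analysis.UnboundedOperators.collisionFrequency v = Literature.Analysis.UnboundedOperators.collisionFrequency w :=
  fun _ _ h => collisionFrequency_eq_of_norm_eq h

/-! ### Moments of the surface measure of `S² ⊂ ℝ³` -/

/-- `σ(S²) = 4π` for the surface measure `sphereMeasure = volume.toSphere` of `ℝ³`
(`σ(S^{d-1}) = d · vol(B₁)`, `vol(B₁) = 4π/3`). [folklore] -/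
theorem sphereMeasure_real_univ_fin3 :
    (sphereMeasure : Measure S2).real univ = 4 * π := by
  rw [show (sphereMeasure : Measure S2) = (volume : Measure E3).toSphere from rfl,
    Measure.toSphere_real_apply_univ, finrank_euclideanSpace_fin, Measure.real,
    EuclideanSpace.volume_ball_fin_three]
  rw [ENNReal.toReal_mul, ENNReal.ofReal_one, one_pow, ENNReal.toReal_one,
    ENNReal.toReal_ofReal (by positivity)]
  ring

/-- Odd integrands have zero sphere integral: `F(-ω) = -F(ω) ⟹ ∫ F dσ = 0` (the antipodal map is a
linear isometry, hence preserves `σ`; vector-valued `F` allowed, no integrability needed). [folklore] -/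
theorem integral_sphere_eq_zero_of_odd {G : Type*} [NormedAddCommGroup G] [NormedSpace ℝ G]
    {F : S2 → G} (hF : ∀ ω, F (-ω) = -F ω) :
    ∫ ω, F ω ∂(sphereMeasure : Measure S2) = 0 := by
  have h := integral_sphere_comp_isometry (LinearIsometryEquiv.neg ℝ (E := E3)) F
  have h' : ∀ ω : S2,
      (mapsTo_sphere_linearIsometryEquiv (LinearIsometryEquiv.neg ℝ (E := E3))).restrict _ _ _ ω = -ω :=
    fun ω => Subtype.ext (by simp [MapsTo.val_restrict_apply])
  simp_rw [h', hF, integral_neg] at h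
  have h2 : (2 : ℝ) • ∫ ω, F ω ∂(sphereMeasure : Measure S2) = 0 := by
    rw [two_smul]
    nth_rewrite 1 [← h]
    exact neg_add_cancel _
  exact (smul_eq_zero.1 h2).resolve_left two_ne_zero

/-- The barycentre of the sphere is the origin: `∫ ω dσ = 0`. [folklore] -/
theorem integral_sphere_coe_eq_zero : ∫ ω, (ω : E3) ∂(sphereMeasure : Measure S2) = 0 :=
  integral_sphere_eq_zero_of_odd fun ω => by simp

/-- Continuous functions on the (compact) sphere are `σ`-integrable. [folklore] -/
theorem integrable_sphere_of_continuous' {G : Type*} [NormedAddCommGroup G] {F : S2 → G}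
    (hF : Continuous F) : Integrable F (sphereMeasure : Measure S2) := by
  haveI := isFiniteMeasure_sphereMeasure (E := E3)
  exact hF.integrable_of_hasCompactSupport (HasCompactSupport.of_compactSpace _)

/-- The second moment `∫ ⟪a, ω⟫² dσ` is invariant under linear isometries: `a ↦ R a`. [folklore] -/
theorem integral_sphere_inner_sq_map (A : E3 ≃ₗᵢ[ℝ] E3) (a : E3) :
    ∫ ω, ⟪A a, (ω : E3)⟫_ℝ ^ 2 ∂(sphereMeasure : Measure S2) =
      ∫ ω, ⟪a, (ω : E3)⟫_ℝ ^ 2 ∂(sphereMeasure : Measure S2) := by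
  rw [← integral_sphere_comp_isometry A (fun ω : S2 => ⟪A a, (ω : E3)⟫_ℝ ^ 2)]
  congr 1 with ω
  simp [MapsTo.val_restrict_apply, LinearIsometryEquiv.inner_map_map]

/-- The second moment `∫ ⟪a, ω⟫² dσ` depends on `|a|` only (reflections act transitively on spheres).
[folklore] -/
theorem integral_sphere_inner_sq_eq_of_norm_eq {a b : E3} (h : ‖a‖ = ‖b‖) :
    ∫ ω, ⟪a, (ω : E3)⟫_ℝ ^ 2 ∂(sphereMeasure : Measure S2) =
      ∫ ω, ⟪b, (ω : E3)⟫_ℝ ^ 2 ∂(sphereMeasure : Measure S2) := by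
  rw [← integral_sphere_inner_sq_map ((ℝ ∙ (a - b))ᗮ.reflection) a, Submodule.reflection_sub h]

/-- **Second moments of `S²`**: `∫_{S²} ⟪a, ω⟫² dσ(ω) = (4π/3) |a|²` (the invariant quadratic form has
trace `∫ |ω|² dσ = 4π` over an orthonormal basis, and is a multiple of `|a|²`). [folklore] -/
theorem integral_sphere_inner_sq (a : E3) :
    ∫ ω, ⟪a, (ω : E3)⟫_ℝ ^ 2 ∂(sphereMeasure : Measure S2) = 4 * π / 3 * ‖a‖ ^ 2 := by
  haveI := isFiniteMeasure_sphereMeasure (E := E3)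
  set b := EuclideanSpace.basisFun (Fin 3) ℝ with hb
  have hq : ∀ i, ∫ ω, ⟪b i, (ω : E3)⟫_ℝ ^ 2 ∂(sphereMeasure : Measure S2) =
      ∫ ω, ⟪b 0, (ω : E3)⟫_ℝ ^ 2 ∂(sphereMeasure : Measure S2) := fun i =>
    integral_sphere_inner_sq_eq_of_norm_eq (by rw [b.orthonormal.1 i, b.orthonormal.1 0])
  have hsum : ∑ i, ∫ ω, ⟪b i, (ω : E3)⟫_ℝ ^ 2 ∂(sphereMeasure : Measure S2) = 4 * π := by
    rw [← integral_finsetSum _ (fun i _ => integrable_sphere_of_continuous' (by fun_prop))]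
    have : ∀ ω : S2, ∑ i, ⟪b i, (ω : E3)⟫_ℝ ^ 2 = 1 := fun ω => by
      rw [b.sum_sq_inner_right, norm_eq_of_mem_sphere ω, one_pow]
    simp_rw [this]
    rw [integral_const, smul_eq_mul, mul_one, sphereMeasure_real_univ_fin3]
  have h0 : ∫ ω, ⟪b 0, (ω : E3)⟫_ℝ ^ 2 ∂(sphereMeasure : Measure S2) = 4 * π / 3 := by
    simp_rw [hq] at hsum
    rw [Finset.sum_const, Finset.card_univ, Fintype.card_fin, nsmul_eq_mul] at hsum
    push_cast at hsum
    linarith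
  by_cases ha : a = 0
  · subst ha
    simp
  have han : 0 < ‖a‖ := norm_pos_iff.2 ha
  set u : E3 := ‖a‖⁻¹ • a with hu
  have hun : ‖u‖ = 1 := by rw [hu, norm_smul, norm_inv, norm_norm, inv_mul_cancel₀ han.ne']
  have hau : a = ‖a‖ • u := by rw [hu, smul_smul, mul_inv_cancel₀ han.ne', one_smul]
  have h1 : ∀ ω : S2, ⟪a, (ω : E3)⟫_ℝ ^ 2 = ‖a‖ ^ 2 * ⟪u, (ω : E3)⟫_ℝ ^ 2 := fun ω => by
    conv_lhs => rw [hau]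
    rw [real_inner_smul_left, mul_pow]
  simp_rw [h1]
  rw [integral_const_mul, integral_sphere_inner_sq_eq_of_norm_eq (b := b 0) (by rw [hun, b.orthonormal.1 0]),
    h0]
  ring

/-- Mixed second moments of `S²` (polarisation): `∫_{S²} ⟪a, ω⟫ ⟪c, ω⟫ dσ(ω) = (4π/3) ⟪a, c⟫`, i.e.
`∫ ωᵢ ωⱼ dσ = (4π/3) δᵢⱼ`. [folklore] -/
theorem integral_sphere_inner_mul_inner (a c : E3) :
    ∫ ω, ⟪a, (ω : E3)⟫_ℝ * ⟪c, (ω : E3)⟫_ℝ ∂(sphereMeasure : Measure S2) = 4 * π / 3 * ⟪a, c⟫_ℝ := by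
  have hpol : ∀ ω : S2, ⟪a, (ω : E3)⟫_ℝ * ⟪c, (ω : E3)⟫_ℝ =
      4⁻¹ * (⟪a + c, (ω : E3)⟫_ℝ ^ 2 - ⟪a - c, (ω : E3)⟫_ℝ ^ 2) := fun ω => by
    rw [inner_add_left, inner_sub_left]; ring
  simp_rw [hpol]
  rw [integral_const_mul, integral_sub (integrable_sphere_of_continuous' (by fun_prop))
    (integrable_sphere_of_continuous' (by fun_prop)), integral_sphere_inner_sq, integral_sphere_inner_sq,
    norm_add_sq_real, norm_sub_sq_real]
  ring

/-- **Vector form of the second moments**: `∫_{S²} ⟪a, ω⟫ ω dσ(ω) = (4π/3) a`. [folklore] -/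
theorem integral_sphere_inner_smul (a : E3) :
    ∫ ω, ⟪a, (ω : E3)⟫_ℝ • (ω : E3) ∂(sphereMeasure : Measure S2) = (4 * π / 3) • a := by
  refine ext_inner_left ℝ fun c => ?_
  rw [← integral_inner (integrable_sphere_of_continuous' (by fun_prop)) c]
  simp_rw [inner_smul_right]
  rw [integral_sphere_inner_mul_inner, real_inner_comm a c]

/-! ### Z2: the dipole (`ℓ = 1`) profile -/

/-- **The dipole profile** `Φ_ψ(r) := (3 / (4π r)) ∫_{S²} ψ(r ω) ω dσ(ω)` of a function `ψ` on `ℝ³` at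
radius `r`: the vector such that the `ℓ = 1` (dipole) component of `ψ` on the sphere `|v| = r` is
`Π₁ψ(v) = ⟪Φ_ψ(|v|), v⟫` (for `ψ(v) = ⟪Φ(|v|), v⟫` one recovers `Φ_ψ = Φ`, `t12_dipoleProfile_of_dipole`).
This is literally the expression in the last clause of the registered sub-goal
`t12_logLinearPreimage_and_dipoleModulus`. Bochner integral (junk `0` if not integrable); junk value `0` at
`r = 0` (`3 / (4π·0) = 0`), never used. [folklore] -/
def dipoleProfile (ψ : EuclideanSpace ℝ (Fin 3) → ℝ) (r : ℝ) : EuclideanSpace ℝ (Fin 3) :=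
  (3 / (4 * Real.pi * r)) •
    ∫ ω : Metric.sphere (0 : EuclideanSpace ℝ (Fin 3)) 1,
      ψ (r • (ω : EuclideanSpace ℝ (Fin 3))) • (ω : EuclideanSpace ℝ (Fin 3)) ∂sphereMeasure

/-- A scalar density times the position vector is `σ`-integrable as soon as the density is. [folklore] -/
theorem integrable_smul_sphere {φ : S2 → ℝ} (h : Integrable φ (sphereMeasure : Measure S2)) :
    Integrable (fun ω : S2 => φ ω • (ω : E3)) (sphereMeasure : Measure S2) :=
  h.mono (h.aestronglyMeasurable.smul continuous_subtype_val.aestronglyMeasurable)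
    (Eventually.of_forall fun ω => by rw [norm_smul, norm_eq_of_mem_sphere ω, mul_one])

/-- The trace of a continuous `ψ : ℝ³ → ℝ` on the sphere of radius `r` is `σ`-integrable. [folklore] -/
theorem integrable_sphere_trace_of_continuous {ψ : E3 → ℝ} (hψ : Continuous ψ) (r : ℝ) :
    Integrable (fun ω : S2 => ψ (r • (ω : E3))) (sphereMeasure : Measure S2) :=
  integrable_sphere_of_continuous' (by fun_prop)

/-- Locality: the profile at radius `r` only sees `ψ` on the sphere `|v| = r`. [folklore] -/
theorem dipoleProfile_congr {ψ₁ ψ₂ : E3 → ℝ} {r : ℝ} (h : ∀ ω : S2, ψ₁ (r • (ω : E3)) = ψ₂ (r • (ω : E3))) :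
    dipoleProfile ψ₁ r = dipoleProfile ψ₂ r := by
  unfold dipoleProfile
  simp_rw [h]

/-- If `ψ` vanishes on the sphere `|v| = r` (e.g. beyond the support radius) its profile vanishes there.
[folklore] -/
theorem dipoleProfile_eq_zero_of_forall {ψ : E3 → ℝ} {r : ℝ} (h : ∀ ω : S2, ψ (r • (ω : E3)) = 0) :
    dipoleProfile ψ r = 0 := by
  unfold dipoleProfile
  simp_rw [h, zero_smul, integral_zero, smul_zero]

/-- Homogeneity: `Φ_{cψ} = c Φ_ψ` (no integrability needed). [folklore] -/
theorem dipoleProfile_const_mul (c : ℝ) (ψ : E3 → ℝ) (r : ℝ) :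
    dipoleProfile (fun v => c * ψ v) r = c • dipoleProfile ψ r := by
  unfold dipoleProfile
  simp_rw [mul_smul]
  rw [integral_smul, smul_comm]

/-- `Φ_{-ψ} = -Φ_ψ` (no integrability needed). [folklore] -/
theorem dipoleProfile_neg (ψ : E3 → ℝ) (r : ℝ) :
    dipoleProfile (fun v => -ψ v) r = -dipoleProfile ψ r := by
  unfold dipoleProfile
  simp_rw [neg_smul]
  rw [integral_neg, smul_neg]

/-- Additivity `Φ_{ψ₁+ψ₂} = Φ_{ψ₁} + Φ_{ψ₂}` (both traces `σ`-integrable on the sphere of radius `r`).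
[folklore] -/
theorem dipoleProfile_add {ψ₁ ψ₂ : E3 → ℝ} {r : ℝ}
    (h₁ : Integrable (fun ω : S2 => ψ₁ (r • (ω : E3))) (sphereMeasure : Measure S2))
    (h₂ : Integrable (fun ω : S2 => ψ₂ (r • (ω : E3))) (sphereMeasure : Measure S2)) :
    dipoleProfile (fun v => ψ₁ v + ψ₂ v) r = dipoleProfile ψ₁ r + dipoleProfile ψ₂ r := by
  unfold dipoleProfile
  simp_rw [add_smul]
  rw [integral_add (integrable_smul_sphere h₁) (integrable_smul_sphere h₂), smul_add]

/-- `Φ_{ψ₁-ψ₂} = Φ_{ψ₁} - Φ_{ψ₂}` (both traces `σ`-integrable on the sphere of radius `r`). [folklore] -/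
theorem dipoleProfile_sub {ψ₁ ψ₂ : E3 → ℝ} {r : ℝ}
    (h₁ : Integrable (fun ω : S2 => ψ₁ (r • (ω : E3))) (sphereMeasure : Measure S2))
    (h₂ : Integrable (fun ω : S2 => ψ₂ (r • (ω : E3))) (sphereMeasure : Measure S2)) :
    dipoleProfile (fun v => ψ₁ v - ψ₂ v) r = dipoleProfile ψ₁ r - dipoleProfile ψ₂ r := by
  unfold dipoleProfile
  simp_rw [sub_smul]
  rw [integral_sub (integrable_smul_sphere h₁) (integrable_smul_sphere h₂), smul_sub]

/-- **Rotation equivariance of the dipole profile**: `Φ_{ψ ∘ R}(r) = R⁻¹ Φ_ψ(r)` for every linear isometry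
`R` of `ℝ³` and every `ψ` (substitute `ω ↦ R ω`; `σ` is `R`-invariant and `R⁻¹` commutes with the Bochner
integral; no integrability needed). With the isotropy of `L` this is what makes the `ℓ = 1` sector
equation rotation-covariant. [folklore] -/
theorem dipoleProfile_comp_linearIsometryEquiv (ψ : E3 → ℝ) (A : E3 ≃ₗᵢ[ℝ] E3) (r : ℝ) :
    dipoleProfile (ψ ∘ A) r = A.symm (dipoleProfile ψ r) := by
  unfold dipoleProfile
  rw [LinearIsometryEquiv.map_smul]
  congr 1
  have h := (A.symm.toContinuousLinearEquiv : E3 ≃L[ℝ] E3).integral_comp_comm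
    (μ := (sphereMeasure : Measure S2)) (fun ω : S2 => ψ (r • (ω : E3)) • (ω : E3))
  simp only [LinearIsometryEquiv.coe_toContinuousLinearEquiv] at h
  rw [← h, ← integral_sphere_comp_isometry A (fun ω : S2 => A.symm (ψ (r • (ω : E3)) • (ω : E3)))]
  congr 1 with ω
  simp [MapsTo.val_restrict_apply]

/-- **Sup bound of the dipole profile**: if `|ψ| ≤ S` on the sphere `|v| = r > 0` then
`|Φ_ψ(r)| ≤ 3 S / r` (`|∫ ψ(rω) ω dσ| ≤ S σ(S²) = 4π S`). [folklore] -/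
theorem norm_dipoleProfile_le {ψ : E3 → ℝ} {r S : ℝ} (hr : 0 < r)
    (hS : ∀ ω : S2, |ψ (r • (ω : E3))| ≤ S) :
    ‖dipoleProfile ψ r‖ ≤ 3 * S / r := by
  haveI := isFiniteMeasure_sphereMeasure (E := E3)
  unfold dipoleProfile
  rw [norm_smul, Real.norm_of_nonneg (by positivity)]
  have hint : ‖∫ ω, ψ (r • (ω : E3)) • (ω : E3) ∂(sphereMeasure : Measure S2)‖ ≤
      S * (sphereMeasure : Measure S2).real univ :=
    norm_integral_le_of_norm_le_const (Eventually.of_forall fun ω => by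
      rw [norm_smul, norm_eq_of_mem_sphere ω, mul_one, Real.norm_eq_abs]; exact hS ω)
  rw [sphereMeasure_real_univ_fin3] at hint
  calc 3 / (4 * π * r) * ‖∫ ω, ψ (r • (ω : E3)) • (ω : E3) ∂(sphereMeasure : Measure S2)‖
      ≤ 3 / (4 * π * r) * (S * (4 * π)) := mul_le_mul_of_nonneg_left hint (by positivity)
    _ = 3 * S / r := by field_simp

/-- **Radial (`ℓ = 0`) functions have no dipole**: `Φ_{f(|·|)}(r) = 0` (the integrand `f(|r|) ω` is odd).
[folklore] -/
theorem dipoleProfile_radial (f : ℝ → ℝ) (r : ℝ) : dipoleProfile (fun v => f ‖v‖) r = 0 := by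
  unfold dipoleProfile
  have : ∀ ω : S2, f ‖r • (ω : E3)‖ = f |r| := fun ω => by
    rw [norm_smul, norm_eq_of_mem_sphere ω, mul_one, Real.norm_eq_abs]
  simp_rw [this]
  rw [integral_sphere_eq_zero_of_odd (fun ω => by simp), smul_zero]

/-- **Registered helper `t12_dipoleProfile_of_dipole`** (Z2): **the dipole profile reproduces dipoles** —
for every vector profile `Φ : (0,∞) → ℝ³` and `r > 0`, the function `ψ(v) = ⟪Φ(|v|), v⟫` has
`Φ_ψ(r) = (3/(4π r)) ∫ ⟪Φ(|rω|), rω⟫ ω dσ(ω) = Φ(r)`, by the second moments `∫ ⟪a, ω⟫ ω dσ = (4π/3) a`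
of `S²`. (Stated with `dipoleProfile` unfolded, `inner ℝ x y = ⟪x, y⟫`.) [folklore] -/
theorem t12_dipoleProfile_of_dipole : ∀ (Φ : ℝ → EuclideanSpace ℝ (Fin 3)) (r : ℝ), 0 < r → (3 / (4 * Real.pi * r)) • ∫ ω : Metric.sphere (0 : EuclideanSpace ℝ (Fin 3)) 1, inner ℝ (Φ ‖r • (ω : EuclideanSpace ℝ (Fin 3))‖) (r • (ω : EuclideanSpace ℝ (Fin 3))) • (ω : EuclideanSpace ℝ (Fin 3)) ∂Literature.MathematicalPhysics.KineticTheory.sphereMeasure = Φ r := by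
  intro Φ r hr
  have h1 : ∀ ω : S2, ⟪Φ ‖r • (ω : E3)‖, r • (ω : E3)⟫_ℝ • (ω : E3) = r • (⟪Φ r, (ω : E3)⟫_ℝ • (ω : E3)) := by
    intro ω
    rw [norm_smul, norm_eq_of_mem_sphere ω, mul_one, Real.norm_of_nonneg hr.le, inner_smul_right, mul_smul]
  simp_rw [h1]
  rw [integral_smul, integral_sphere_inner_smul, smul_smul, smul_smul]
  have : 3 / (4 * π * r) * r * (4 * π / 3) = 1 := by
    field_simp
  rw [this, one_smul]

/-- `dipoleProfile` form of `t12_dipoleProfile_of_dipole`: `Φ_{⟪Φ(|·|), ·⟫}(r) = Φ(r)` for `r > 0`.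
[folklore] -/
theorem dipoleProfile_dipole (Φ : ℝ → E3) {r : ℝ} (hr : 0 < r) :
    dipoleProfile (fun v => ⟪Φ ‖v‖, v⟫_ℝ) r = Φ r :=
  t12_dipoleProfile_of_dipole Φ r hr

/-- Scalar dipoles: for `ψ(v) = ⟪a, v⟫ φ(|v|)`, `Φ_ψ(r) = φ(r) a` (`r > 0`). [folklore] -/
theorem dipoleProfile_inner_mul_radial (a : E3) (φ : ℝ → ℝ) {r : ℝ} (hr : 0 < r) :
    dipoleProfile (fun v => ⟪a, v⟫_ℝ * φ ‖v‖) r = φ r • a := by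
  rw [← dipoleProfile_dipole (fun s => φ s • a) hr]
  refine dipoleProfile_congr fun ω => ?_
  rw [real_inner_smul_left, mul_comm]

/-- Linear functions: `Φ_{⟪a, ·⟫}(r) = a` (`r > 0`). [folklore] -/
theorem dipoleProfile_inner_const (a : E3) {r : ℝ} (hr : 0 < r) :
    dipoleProfile (fun v => ⟪a, v⟫_ℝ) r = a := by
  simpa using dipoleProfile_dipole (fun _ => a) hr

/-- **Dipole profile of a collision invariant**: `Φ_{a + ⟪b,·⟫ + c|·|²}(r) = b` (`r > 0`): the constants and
the energy are radial (no dipole), the momentum components are reproduced. [folklore] -/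
theorem dipoleProfile_collisionInvariant (a c : ℝ) (b : E3) {r : ℝ} (hr : 0 < r) :
    dipoleProfile (fun v => a + ⟪b, v⟫_ℝ + c * ‖v‖ ^ 2) r = b := by
  rw [dipoleProfile_add (integrable_sphere_trace_of_continuous (ψ := fun v => a + ⟪b, v⟫_ℝ) (by fun_prop) r)
      (integrable_sphere_trace_of_continuous (ψ := fun v => c * ‖v‖ ^ 2) (by fun_prop) r),
    dipoleProfile_add (integrable_sphere_trace_of_continuous (ψ := fun _ => a) (by fun_prop) r)
      (integrable_sphere_trace_of_continuous (ψ := fun v => ⟪b, v⟫_ℝ) (by fun_prop) r),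
    dipoleProfile_inner_const b hr, dipoleProfile_radial (fun _ => a) r,
    dipoleProfile_radial (fun s => c * s ^ 2) r]
  simp

/-- **Idempotence of the dipole projection**: the profile of the dipole part `Π₁ψ(v) = ⟪Φ_ψ(|v|), v⟫` is
again `Φ_ψ` (`r > 0`), i.e. `Π₁ Π₁ = Π₁` radius by radius. [folklore] -/
theorem dipoleProfile_dipolePart (ψ : E3 → ℝ) {r : ℝ} (hr : 0 < r) :
    dipoleProfile (fun v => ⟪dipoleProfile ψ ‖v‖, v⟫_ℝ) r = dipoleProfile ψ r :=
  dipoleProfile_dipole (dipoleProfile ψ) hr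

/-- The un-normalised dipole moment `r ↦ ∫ ψ(r ω) ω dσ` of a continuous `ψ` is continuous in the radius
(parametric integral of a jointly continuous integrand over a compact space). [folklore] -/
theorem continuous_integral_sphere_trace_smul {ψ : E3 → ℝ} (hψ : Continuous ψ) :
    Continuous fun r : ℝ => ∫ ω, ψ (r • (ω : E3)) • (ω : E3) ∂(sphereMeasure : Measure S2) := by
  haveI := isFiniteMeasure_sphereMeasure (E := E3)
  have hc : Continuous (Function.uncurry fun (r : ℝ) (ω : S2) => ψ (r • (ω : E3)) • (ω : E3)) := by
    unfold Function.uncurry; fun_prop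
  exact (continuous_parametric_integral_of_continuous hc isCompact_univ).congr
    fun r => by rw [Measure.restrict_univ]

/-- **Continuity of the dipole profile in the radius** on `(0, ∞)` for continuous `ψ`. [folklore] -/
theorem continuousOn_dipoleProfile {ψ : E3 → ℝ} (hψ : Continuous ψ) :
    ContinuousOn (dipoleProfile ψ) (Ioi 0) := by
  have h1 : ContinuousOn (fun r : ℝ => 3 / (4 * Real.pi * r)) (Ioi 0) :=
    continuousOn_const.div (by fun_prop : Continuous fun r : ℝ => 4 * Real.pi * r).continuousOn
      fun r hr => by have : (0 : ℝ) < r := hr; positivity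
  exact h1.smul (continuous_integral_sphere_trace_smul hψ).continuousOn

end Summit.AtomisticToContinuum.HydrodynamicLimit.Theorems.ClampedCorrectorBirth
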